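import Summits.SmoothPoincare4.SmoothPoincare4.Theorems.SullivanDualHyperbolicEndTaubesModelDefs
import Summits.SmoothPoincare4.SmoothPoincare4.Theorems.SullivanDualHyperbolicEndTaubesModelIdentities

/-!
# Route `SullivanDual`, crux `HyperbolicEnd` (stmt-SmoothPoincare4-7825), line `taubes-circle-pencil`:
# Taubes' singular structure `J♭` is `ωT`-symplectic

Registered helper `helper_taubesForm_taubesJ_taubesJ` of the checked skeleton: on the punctured flat
tube `taubesTube δ ∖ taubesCore`, `0 < δ < 1`, Taubes' singular almost complex structure
`J♭ = taubesJ` preserves his untwisted near-symplectic model form `ωT = taubesForm`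
(Taubes, Geom. Topol. 2 (1998), §1, eq. (1.4): `J♭` is the `ω`-compatible metric almost complex
structure of `√2 ω/|ω|`):

  `ωT(J♭u, J♭v) = ωT(u, v)`.

This is the identity used whenever tangent planes of `J♭`-curves are rotated by `J♭` (the crux's local
question (Q₂) on the punctured tubes).

Proof (no coordinates needed beyond the landed identities of
`Theorems/SullivanDualHyperbolicEndTaubesModelIdentities.lean`): with `g⟨·, ·⟩` the toroidal inner
product `dt⊗dt + da⊗da + dy₂⊗dy₂ + dy₃⊗dy₃`,
* `ωT(J♭u, J♭v) = −ωT(J♭v, J♭u) = −|∇Q| g⟨J♭v, u⟩` (`helper_taubesForm_swap`, then the compatibility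
  `helper_taubesForm_taubesJ` with `(u, v) := (J♭v, u)`);
* `ωT(u, v) = ωT(u, −J♭(J♭v)) = −ωT(u, J♭(J♭v)) = −|∇Q| g⟨u, J♭v⟩` (`helper_taubesJ_sq`, oddness of
  `ωT` in its second slot, compatibility with `v := J♭v`);
* `g` is symmetric (`ring`).
-/

-- the registered namespace `Summit.SmoothPoincare4.SmoothPoincare4.…` repeats a component (P = Sub)
set_option linter.dupNamespace false

noncomputable section

namespace Summit.SmoothPoincare4.SmoothPoincare4.Cruxes.HyperbolicEnd.TaubesCirclePencil

/-- `ωT` is odd in its second argument: `ωT(u, −w) = −ωT(u, w)` (each building block `dt`, `da`,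
`dQ`, `dyᵢ` of `taubesForm` is linear in the vector). [folklore] -/
private theorem taubesForm_neg_right (y u w : EuclideanSpace ℝ (Fin 4)) :
    taubesForm y u (-w) = -taubesForm y u w := by
  simp only [taubesForm, taubesDt, taubesDa, taubesDQ, PiLp.neg_apply]
  ring

/-- **`J♭` is `ωT`-symplectic on the punctured tube**: `ωT(J♭u, J♭v) = ωT(u, v)` for Taubes'
singular almost complex structure `J♭ = taubesJ` and untwisted model form `ωT = taubesForm`, at every
point of `taubesTube δ ∖ taubesCore`, `0 < δ < 1` — the consequence of the compatibility
`ωT(u, J♭v) = |∇Q| g_tor(u, v)` and `J♭² = −1`. [cite: Taubes1998S1B3, §1 eq. (1.4)] -/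
theorem helper_taubesForm_taubesJ_taubesJ :
    ∀ (δ : ℝ) (y : EuclideanSpace ℝ (Fin 4)), 0 < δ → δ < 1 → y ∈ taubesTube δ → y ∉ taubesCore →
      ∀ u v : EuclideanSpace ℝ (Fin 4),
        taubesForm y (taubesJ y u) (taubesJ y v) = taubesForm y u v := by
  intro δ y hδ0 hδ hy hc u v
  -- `ωT(J♭u, J♭v) = −ωT(J♭v, J♭u)`
  have hswap := helper_taubesForm_swap y (taubesJ y v) (taubesJ y u)
  -- `ωT(J♭v, J♭u) = |∇Q| g⟨J♭v, u⟩`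
  have hA := helper_taubesForm_taubesJ δ y hδ0 hδ hy hc (taubesJ y v) u
  -- `ωT(u, J♭(J♭v)) = |∇Q| g⟨u, J♭v⟩`, and `J♭(J♭v) = −v`
  have hB := helper_taubesForm_taubesJ δ y hδ0 hδ hy hc u (taubesJ y v)
  rw [helper_taubesJ_sq δ y hδ0 hδ hy hc v, taubesForm_neg_right] at hB
  rw [hswap, hA]
  linear_combination hB

end Summit.SmoothPoincare4.SmoothPoincare4.Cruxes.HyperbolicEnd.TaubesCirclePencil

end
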